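import Summits.QuantumFields.YangMills.Theorems.LuscherReductionTwistedTraceScalingBOCentralChart
import Summits.QuantumFields.YangMills.Theorems.TwistedTraceScaling.Negative.CentralGaussianRadiusWindow
import HarnessLib

/-!
# The lower bound on the top eigenvalue `stiffGaussTop L t b ≥ (π/(2(96t+b)))^{dim/2}` and the record two-sided form (upper half = cdisprove R46 `stiffGaussTop_le_pow`)
# (lane A of S-BASE, crux `TwistedTraceScaling` stmt-QuantumFields-20203, C4-CORE, the (OD) pen; the informativeness window of the (C1d) constants, `pub/ym-fleet/ym-luscher-20007-p1/COARSE-DESIGN.md` §28.6)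

Each factor of `stiffGaussTop L t b = Πᵢ √(π/(aᵢ + b + √(aᵢ² + 2aᵢb)))` lies in `[√(π/(96t + b + (96t+b))), √(π/b)]` because `0 ≤ aᵢ ≤ 96t` (`…BOCentralChart.smul_stiffHessian_eigenvalues_le`) and
`√(aᵢ²+2aᵢb) ≤ 96t + b` (`stiffGaussExp_coeff_le`).  At `(t,b) = (β/2, β)`: `(π/(98β))^{dim/2}·… ≤ stiffGaussTop ≤ (π/β)^{dim/2}` with `dim = 3|E|` — so the flat Gaussian tail
`e^{−βm²/2}(π/(β/2))^{dim/2}` of `…BOCentralTube` is below `ε·stiffGaussTop` as soon as `βm² > dim·log 196 + 2 log(1/ε)`: the lower bounds of `…BOCentralTube` are INFORMATIVE exactly in the window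
`m² = min(ρ−2T, R₀−6T²R)² > 98R²(1 + 18T²) + 9L³·log 196/β` (cdisprove R46 computed the same line from above).
HONEST FRAMING: elementary bounds for a stub of a child of the CONDITIONAL route R2b1; C4-CORE OPEN; not infinite volume, not a gap, not Clay.
-/

set_option autoImplicit false

noncomputable section

open Real
open scoped BigOperators
open Literature.MathematicalPhysics.QuantumFieldTheory
open Literature.MathematicalPhysics.QuantumLattice

namespace Summit.QuantumFields.YangMills.Theorems.FemtoTransferGap.TwoLattice.ConstTube

open Summit.QuantumFields.YangMills.Theorems.FemtoTransferGap
open Summit.QuantumFields.YangMills.Theorems.FemtoTransferGap.TwoLattice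
open Summit.QuantumFields.YangMills.Theorems.FemtoTransferGap.TwoLattice.Stiff

variable {L : ℕ} [NeZero L]

/-- ★ **Lower bound on the top eigenvalue**: `√(π/(2(96t+b)))^{3|E|} ≤ stiffGaussTop L t b` (`t ≥ 0`, `b > 0`). [folklore] -/
theorem stiffGaussTop_ge {t : ℝ} (ht : 0 ≤ t) {b : ℝ} (hb : 0 < b) :
    Real.sqrt (π / (2 * (96 * t + b))) ^ Fintype.card (Edge 3 L × Fin 3) ≤ stiffGaussTop L t b := by
  unfold stiffGaussTop
  have hprod : (∏ _i : Fin (Fintype.card (Edge 3 L × Fin 3)), Real.sqrt (π / (2 * (96 * t + b)))) = Real.sqrt (π / (2 * (96 * t + b))) ^ Fintype.card (Edge 3 L × Fin 3) := by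
    rw [Finset.prod_const, Finset.card_univ, Fintype.card_fin]
  rw [← hprod]
  refine Finset.prod_le_prod (fun i _ => Real.sqrt_nonneg _) fun i _ => ?_
  have ha0 := smul_stiffHessian_eigenvalues_nonneg (L := L) ht i
  have ha := smul_stiffHessian_eigenvalues_le (L := L) ht i
  have hc := stiffGaussExp_coeff_le (L := L) ht hb.le i
  refine Real.sqrt_le_sqrt (div_le_div_of_nonneg_left Real.pi_pos.le (by positivity) ?_)
  linarith

/-- At the record normalisation `(t,b) = (β/2, β)`: `√(π/(98β))^{3|E|} ≤ stiffGaussTop L (β/2) β ≤ √(π/β)^{3|E|}` (`β > 0`). [folklore] -/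
theorem stiffGaussTop_record_bounds {β : ℝ} (hβ : 0 < β) :
    Real.sqrt (π / (98 * β)) ^ Fintype.card (Edge 3 L × Fin 3) ≤ stiffGaussTop L (β / 2) β ∧ stiffGaussTop L (β / 2) β ≤ Real.sqrt (π / β) ^ Fintype.card (Edge 3 L × Fin 3) := by
  have h := stiffGaussTop_ge (L := L) (t := β / 2) (by positivity) hβ
  have e : 2 * (96 * (β / 2) + β) = 98 * β := by ring
  rw [e] at h
  exact ⟨h, Summit.QuantumFields.YangMills.Theorems.TwistedTraceScaling.Negative.R46.stiffGaussTop_le_pow (L := L) (by positivity) hβ⟩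

end Summit.QuantumFields.YangMills.Theorems.FemtoTransferGap.TwoLattice.ConstTube

end
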